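/-
Copyright (c) 2026 the pub-hodgecm-mathlib formalisation cell (harness21).  Prover seat hodgecm-mathlib-K2E3-p22 (g0),
Track B «K2-LIT» ∕ h413, line `K2_E3_EllipticInputs`, unit U5EPU6HSide, SIGS-TABLE row #22 in its ED. 2 «R» form
(`sig_K2E3HInnerStVsLdsKappaZeroR`) — the ★-closable REDUCTION half.  2026-09-03.
-/
import Literature.NumberTheory.Rogawski1990.Ch12Sec5Inputs   -- ★ sockets (M1H) `PacketCharHRegularity`; brings ★ carpet `Ch12Sec5` (`Prop1252`, `InnerGDefined`, `InnerHDefined`) and ★ `Ch12Sec5Defs` (`EllipticData`: `innerG`, `innerH`, `up`, `char`, `charH`, `packetCharH`, `ldsPackets`)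
import HarnessLib

/-!
# K2_E3 road (h413 = stmt-HodgeConjecture-24833), U6-a «`⟨(χ_{St_H(ξ)})^G, χ_{π′}⟩_{G,e} = 0` FOR `π′` IN AN L.D.S. PACKET» — REDUCTION to
# Prop. 12.5.2 ⊕ the l.d.s. character identity read on the elliptic tori ⊕ rank-one orthogonality on `H`

Cell `pub/hodgecm-mathlib` (D-0151), Track B, line `Summits/HodgeConjecture/HodgeConjecture/Cruxes/H413/Lines/K2_E3_EllipticInputs.lean`,
unit module `…Lines/K2_E3_EllipticInputsSigs_U5EPU6HSide.lean`, socket `sig_K2E3HInnerStVsLdsKappaZeroR` (row #22, ED. 2 «R», XL, junction E1):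
«for every l.d.s. packet `P` of `G = U(3)(F)` and every `π′ ∈ P`, `⟨(χ_{St_H(ξ_v)})^G, χ_{π′}⟩_{G,e} = 0`» (Cor. 12.5.4's currency; ED. 1 of the row
used the datum's free `α ↦ α^κ` and was withdrawn, `K2/STATUS.md` 2026-09-03T21:40Z).  Helper file (`--supports stmt-HodgeConjecture-24833
--as helper`, no socket closed); THEOREMS ONLY (no `def`, no instance, no notation, no named fact, no `sorry`); the §12.5 datum `𝔇` is a BINDER
on GENERIC carriers `G ⊃ H` (so the theorems apply verbatim at the organ's pinned datum on `U(Φ₃)(L⁺_v)`).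

THE MATHEMATICS [Rogawski1990, §12.7, proof of Lemma 12.7.2, p. 192: «`Tr(ρ(f_Π^H)) = 0` by the orthogonality relations and the hypothesis
`ρ ≠ ρ(θ)`»], spelled out for `ρ = {St_H(ξ)}` and `π′` in the l.d.s. packet `Π(θ) = {π¹, π²}`:
* (PSVAN) `χ_{π¹} + χ_{π²} = χ_{i_G(θ̃)}` is the character of a principal series, «supported on the conjugacy classes which meet `M`» (§12.6 p. 187),
  hence zero on the elliptic set `G^e` [vanDijk1972] — read here as «`= 0` a.e. on every elliptic Cartan representative `T ∈ 𝒞_G`»;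
* (E1F) the l.d.s. identity «`χ_{π¹(θ)} − χ_{π²(θ)} = ± χ^G_{ρ(θ)}`» (§12.7 p. 191, standing assumption of L. 12.7.2; proved in print as Prop. 13.1.3 (c),
  p. 199 — GLOBAL; junction E1, Dict currency ★ `Ch12Sec7.Dict.LdsCharIdentity`), read as functions a.e. on the elliptic tori: `χ_{π¹} − χ_{π²} =
  s · (χ_θ)^G` with `χ_θ = χ_{ρ(θ)}` a measurable stable class function on `H^e`;
* so `χ_{π′} = ± (s∕2) · (χ_θ)^G` a.e. on the elliptic tori (§1–§2 below), whence `⟨(χ_{St_H})^G, χ_{π′}⟩_{G,e} = conj(± s∕2) · ⟨(χ_{St_H})^G, (χ_θ)^G⟩_{G,e}`;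
* (P1252) PROPOSITION 12.5.2 (p. 184) «`⟨α₁^G, α₂^G⟩_{G,e} = 2 ⟨α₁, α₂⟩_{H,e}`» for stable class functions `α₁, α₂` on `H^e` (★ carpet `Ch12Sec5.Prop1252`);
* (HORTH) the orthogonality relations on `H = U(2)(F) × U(1)(F)` for the DISTINCT square-integrable `H`-packets `{St_H(ξ)} ≠ ρ(θ)`:
  `⟨χ_{St_H(ξ)}, χ_{ρ(θ)}⟩_{H,e} = 0` (p. 184 «The set of restrictions to the elliptic set of the square-integrable representations … form an
  orthonormal basis», rank one via `SL₂` ∕ [JL]) — so the right-hand side vanishes.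

WHAT THIS FILE PROVES (sorry-free, generic datum): §1 `⟨ , ⟩_{G,e}` is conjugate-linear and a.e.-congruent in its second slot
(`innerG_congr_ae_right`, `innerG_const_mul_right`, `innerG_eq_zero_of_ae_eq_const_mul`); §2 the two members of a packet whose character SUM
vanishes and whose character DIFFERENCE is `s · β` a.e. on the elliptic tori are `± (s∕2) · β` there (`char_ae_eq_const_mul_of_sum_zero_of_sub_eq`);
§3 (P1252) ⊕ (HORTH) ⇒ `⟨α₁^G, α₂^G⟩_{G,e} = 0` (`innerG_up_up_eq_zero_of_prop1252`); §4 the CONSEQUENT of `sig_K2E3HInnerStVsLdsKappaZeroR` TOKEN FOR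
TOKEN — `∀ P ∈ 𝔇.ldsPackets, ∀ π' ∈ P, 𝔇.innerG (𝔇.up (𝔇.charH πSt)) (𝔇.char π') = 0` — from (P1252) and, per l.d.s. packet `P = {π¹, π²}`,
the inputs (PSVAN), (E1F), (HORTH) with their definedness side conditions (`innerG_up_charH_char_eq_zero_of_ldsInputs`); the measurability ∕
stability of `χ_{St_H}` is read off (M1H) ★ `PacketCharHRegularity` at the singleton packet (`measurable_stable_charH_of_packetCharHRegularity`).
So row #22R = (P1252) ⊕ (PSVAN) ⊕ (E1F) ⊕ (HORTH), each a separately socketable statement at the pinned datum.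
WHAT IT DOES NOT PROVE: any of the four inputs (Prop. 12.5.2 is the organ's (S-𝔇) carpet relation, XL; (PSVAN) needs van Dijk's support theorem,
trace additivity over `JH(i_G(χ))` and density; (E1F) is junction E1 plus density; (HORTH) is the rank-one orthogonality on `U(2) × U(1)`).
HONEST LABEL: count-neutral; HC_CM is proved only modulo the 7 printed citations (2 remaining named inputs: hLiu418 = stmt-HodgeConjecture-24832,
h413 = stmt-HodgeConjecture-24833) until rung 0 closes; this `--supports` helper retires nothing by itself.

## References
* [Rogawski1990] J. D. Rogawski, *Automorphic Representations of Unitary Groups in Three Variables*, Ann. of Math. Stud. 123 (1990): §12.5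
  Prop. 12.5.2 p. 184, Cor. 12.5.4 p. 186; §12.6 p. 187; §12.7 p. 191 (the l.d.s. identity assumed), proof of Lemma 12.7.2 p. 192; §13.1
  Prop. 13.1.3 (c) p. 199.
* [vanDijk1972] G. van Dijk, *Computation of certain induced characters of p-adic groups*, Math. Ann. 199 (1972) 229–240 (characters of
  parabolically induced representations are supported on `Ad(G)M`).
* [JacquetLanglands1970] H. Jacquet, R. P. Langlands, *Automorphic Forms on GL(2)*, LNM 114 (1970), §15–16 (characters and orthogonality for
  `GL₂` ∕ its inner forms; the rank-one input behind (HORTH)).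
-/

set_option autoImplicit false
-- the mandated namespace has the single-problem summit's repeated segment (`HodgeConjecture.HodgeConjecture`)
set_option linter.dupNamespace false

noncomputable section

open MeasureTheory
open Literature.NumberTheory.Rogawski1990 Literature.NumberTheory.Rogawski1990.Ch12Sec5
open Literature.NumberTheory.Automorphic

namespace Summit.HodgeConjecture.HodgeConjecture.Cruxes.H413.K2E3HInnerStVsLdsKappaZeroROfInputs

section Generic

variable {G H' : Type} [Group G] [TopologicalSpace G] [IsTopologicalGroup G] [MeasurableSpace G]
  [∀ γ : G, MeasurableSpace (G ⧸ Subgroup.centralizer ({γ} : Set G))] [MeasurableSpace (G ⧸ Subgroup.center G)]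
  [Group H'] [TopologicalSpace H'] [IsTopologicalGroup H'] [MeasurableSpace H']

/-! ## §1 `⟨ , ⟩_{G,e}` in its second slot: a.e. congruence on the elliptic tori and conjugate-linearity -/

/-- **`⟨α, β⟩_{G,e}` only sees `β` almost everywhere on the elliptic Cartan representatives**: if `β = β′` `dγ`-a.e. on every `T ∈ 𝒞_G` then
`⟨α, β⟩_{G,e} = ⟨α, β′⟩_{G,e}` (the inner product is `Σ_T |Ω(T,G)|⁻¹ ∫_T D_G² α conj β dγ`, p. 184). [cite: Rogawski1990, §12.5 p. 184] -/
theorem innerG_congr_ae_right (𝔇 : EllipticData G H') (α β β' : G → ℂ)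
    (h : ∀ T ∈ 𝔇.cartanG, ∀ᵐ t : ↥T ∂(𝔇.μT T), β (t : G) = β' (t : G)) :
    𝔇.innerG α β = 𝔇.innerG α β' := by
  unfold EllipticData.innerG
  refine Finset.sum_congr rfl fun T hT => ?_
  congr 1
  refine integral_congr_ae ?_
  filter_upwards [h T hT] with t ht
  rw [ht]

/-- **`⟨ , ⟩_{G,e}` is conjugate-linear in its second slot**: `⟨α, c·β⟩_{G,e} = conj(c) · ⟨α, β⟩_{G,e}` (no convergence hypothesis: both sides
are `0` together when an integral diverges). [cite: Rogawski1990, §12.5 p. 184] -/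
theorem innerG_const_mul_right (𝔇 : EllipticData G H') (α β : G → ℂ) (c : ℂ) :
    𝔇.innerG α (fun g => c * β g) = starRingEnd ℂ c * 𝔇.innerG α β := by
  unfold EllipticData.innerG
  rw [Finset.mul_sum]
  refine Finset.sum_congr rfl fun T _ => ?_
  have hfun : (fun t : ↥T => (𝔇.DG (t : G) : ℂ) ^ 2 * α (t : G) * starRingEnd ℂ (c * β (t : G))) =
      fun t : ↥T => starRingEnd ℂ c * ((𝔇.DG (t : G) : ℂ) ^ 2 * α (t : G) * starRingEnd ℂ (β (t : G))) := by
    funext t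
    rw [map_mul]
    ring
  rw [hfun, integral_const_mul]
  ring

/-- **If `β = c·γ` a.e. on the elliptic tori and `⟨α, γ⟩_{G,e} = 0`, then `⟨α, β⟩_{G,e} = 0`.** [cite: Rogawski1990, §12.5 p. 184] -/
theorem innerG_eq_zero_of_ae_eq_const_mul (𝔇 : EllipticData G H') (α β γ : G → ℂ) (c : ℂ)
    (hβ : ∀ T ∈ 𝔇.cartanG, ∀ᵐ t : ↥T ∂(𝔇.μT T), β (t : G) = c * γ (t : G))
    (hγ : 𝔇.innerG α γ = 0) : 𝔇.innerG α β = 0 := by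
  rw [innerG_congr_ae_right 𝔇 α β (fun g => c * γ g) hβ, innerG_const_mul_right, hγ, mul_zero]

/-! ## §2 The two members of an l.d.s. packet on the elliptic tori: sum zero, difference `s · β` -/

/-- **`χ_{π¹} = (s∕2)·β` and `χ_{π²} = −(s∕2)·β` a.e. on the elliptic tori** when `χ_{π¹} + χ_{π²} = 0` there ((PSVAN): the sum is the character
of the principal series `i_G(θ̃)`, supported off `G^e`, §12.6 p. 187) and `χ_{π¹} − χ_{π²} = s·β` there ((E1F): the l.d.s. identity of §12.7 p. 191
with `β = (χ_{ρ(θ)})^G`).  Pure algebra: `χ_{π¹} = ½((χ_{π¹}+χ_{π²}) + (χ_{π¹}−χ_{π²}))`.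
[cite: Rogawski1990, §12.7 p. 191; §12.6 p. 187] [cite: vanDijk1972, Theorem (support of induced characters)] -/
theorem char_ae_eq_const_mul_of_sum_zero_of_sub_eq (𝔇 : EllipticData G H') (π₁ π₂ : IrrClass G) (β : G → ℂ) (s : ℂ)
    (hsum : ∀ T ∈ 𝔇.cartanG, ∀ᵐ t : ↥T ∂(𝔇.μT T), 𝔇.char π₁ (t : G) + 𝔇.char π₂ (t : G) = 0)
    (hsub : ∀ T ∈ 𝔇.cartanG, ∀ᵐ t : ↥T ∂(𝔇.μT T), 𝔇.char π₁ (t : G) - 𝔇.char π₂ (t : G) = s * β (t : G)) :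
    (∀ T ∈ 𝔇.cartanG, ∀ᵐ t : ↥T ∂(𝔇.μT T), 𝔇.char π₁ (t : G) = (s / 2) * β (t : G)) ∧
      (∀ T ∈ 𝔇.cartanG, ∀ᵐ t : ↥T ∂(𝔇.μT T), 𝔇.char π₂ (t : G) = (-(s / 2)) * β (t : G)) := by
  refine ⟨fun T hT => ?_, fun T hT => ?_⟩
  · filter_upwards [hsum T hT, hsub T hT] with t h₁ h₂
    linear_combination (h₁ + h₂) / 2
  · filter_upwards [hsum T hT, hsub T hT] with t h₁ h₂
    linear_combination (h₁ - h₂) / 2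

/-! ## §3 (P1252) ⊕ (HORTH): orthogonality on `H` transports to `G` -/

/-- **PROP. 12.5.2 turns `H`-orthogonality into `G`-orthogonality**: for measurable stable class functions `α₁, α₂` on `H^e` with the two inner
products defined, `⟨α₁, α₂⟩_{H,e} = 0 ⇒ ⟨α₁^G, α₂^G⟩_{G,e} = 2·0 = 0` (★ `Ch12Sec5.Prop1252`: «`⟨α₁^G, α₂^G⟩_{G,e} = 2 ⟨α₁, α₂⟩_{H,e}`»).
[cite: Rogawski1990, §12.5 Prop. 12.5.2 p. 184] -/
theorem innerG_up_up_eq_zero_of_prop1252 (𝔇 : EllipticData G H') (h1252 : 𝔇.Prop1252) (α₁ α₂ : H' → ℂ)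
    (hm₁ : Measurable α₁) (hm₂ : Measurable α₂)
    (hs₁ : IsStableClassFunOn 𝔇.stConjH 𝔇.ellH α₁) (hs₂ : IsStableClassFunOn 𝔇.stConjH 𝔇.ellH α₂)
    (hG : 𝔇.InnerGDefined (𝔇.up α₁) (𝔇.up α₂)) (hH : 𝔇.InnerHDefined α₁ α₂)
    (horth : 𝔇.innerH α₁ α₂ = 0) : 𝔇.innerG (𝔇.up α₁) (𝔇.up α₂) = 0 := by
  rw [h1252 α₁ α₂ hm₁ hm₂ hs₁ hs₂ hG hH, horth, mul_zero]

/-- **(M1H) at a singleton packet**: `χ_{{π}} = χ_π`. [cite: Rogawski1990, §12.5 p. 186] -/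
theorem packetCharH_singleton (𝔇 : EllipticData G H') (π : IrrClass H') : 𝔇.packetCharH {π} = 𝔇.charH π := by
  funext h
  simp [EllipticData.packetCharH]

/-- **Measurability and stability of `χ_{St_H(ξ)}` on `H^e` from (M1H)** ★ `PacketCharHRegularity` at the singleton square-integrable packet
`{St_H(ξ)} ∈ Π²(H)`. [cite: Rogawski1990, §12.5 pp. 183–184; §1.6 p. 6] -/
theorem measurable_stable_charH_of_packetCharHRegularity (𝔇 : EllipticData G H') (hM1H : 𝔇.PacketCharHRegularity) (π : IrrClass H')
    (hπ : ({π} : Finset (IrrClass H')) ∈ 𝔇.sqPacketsH) :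
    Measurable (𝔇.charH π) ∧ IsStableClassFunOn 𝔇.stConjH 𝔇.ellH (𝔇.charH π) := by
  obtain ⟨hm, -, -, hs, -⟩ := hM1H {π} hπ
  rw [packetCharH_singleton] at hm hs
  exact ⟨hm, hs⟩

/-! ## §4 The consequent of `sig_K2E3HInnerStVsLdsKappaZeroR` from (P1252) ⊕ (PSVAN) ⊕ (E1F) ⊕ (HORTH) -/

/-- **ONE L.D.S. MEMBER**: if `χ_{π′} = c · (χ_θ)^G` a.e. on the elliptic tori for a measurable stable class function `χ_θ` on `H^e` with
`⟨χ_{St_H}, χ_θ⟩_{H,e} = 0` (and the two inner products defined), then `⟨(χ_{St_H})^G, χ_{π′}⟩_{G,e} = conj(c) · 2 · ⟨χ_{St_H}, χ_θ⟩_{H,e} = 0`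
by Prop. 12.5.2. [cite: Rogawski1990, §12.7 Lemma 12.7.2 (proof) p. 192; Prop. 12.5.2 p. 184] -/
theorem innerG_up_charH_char_eq_zero_of_inputs (𝔇 : EllipticData G H') (h1252 : 𝔇.Prop1252) (πSt : IrrClass H') (π' : IrrClass G)
    (hmSt : Measurable (𝔇.charH πSt)) (hsSt : IsStableClassFunOn 𝔇.stConjH 𝔇.ellH (𝔇.charH πSt))
    (χθ : H' → ℂ) (c : ℂ) (hmθ : Measurable χθ) (hsθ : IsStableClassFunOn 𝔇.stConjH 𝔇.ellH χθ)
    (hG : 𝔇.InnerGDefined (𝔇.up (𝔇.charH πSt)) (𝔇.up χθ)) (hH : 𝔇.InnerHDefined (𝔇.charH πSt) χθ)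
    (horthH : 𝔇.innerH (𝔇.charH πSt) χθ = 0)
    (hπ' : ∀ T ∈ 𝔇.cartanG, ∀ᵐ t : ↥T ∂(𝔇.μT T), 𝔇.char π' (t : G) = c * 𝔇.up χθ (t : G)) :
    𝔇.innerG (𝔇.up (𝔇.charH πSt)) (𝔇.char π') = 0 :=
  innerG_eq_zero_of_ae_eq_const_mul 𝔇 _ _ _ c hπ'
    (innerG_up_up_eq_zero_of_prop1252 𝔇 h1252 _ _ hmSt hmθ hsSt hsθ hG hH horthH)

open scoped Classical in
/-- **ROW #22R's CONSEQUENT, TOKEN FOR TOKEN, from (P1252) ⊕ per-packet (PSVAN) ⊕ (E1F) ⊕ (HORTH).**  Let `𝔇` be a §12.5 datum with Prop. 12.5.2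
(`h1252`) and (M1H) (`hM1H`), and `{πSt} ∈ Π²(H)` (`πSt = St_H(ξ_v)` at the organ's pins `hC07`∕`eSq`).  Suppose that every l.d.s. packet `P` is a
pair `{π¹, π²}` carrying a measurable stable class function `χ_θ` on `H^e` («`χ_{ρ(θ)}`») and a scalar `s` («`±1`») such that (HORTH)
`⟨χ_{St_H}, χ_θ⟩_{H,e} = 0` with `⟨χ_{St_H}, χ_θ⟩_{H,e}` and `⟨(χ_{St_H})^G, (χ_θ)^G⟩_{G,e}` defined, (PSVAN) `χ_{π¹} + χ_{π²} = 0` a.e. on every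
elliptic Cartan representative, and (E1F) `χ_{π¹} − χ_{π²} = s·(χ_θ)^G` there.  THEN `∀ P ∈ 𝔇.ldsPackets, ∀ π' ∈ P,
𝔇.innerG (𝔇.up (𝔇.charH πSt)) (𝔇.char π') = 0` — «`Tr(ρ(f_Π^H)) = 0` by the orthogonality relations and the hypothesis `ρ ≠ ρ(θ)`» in
Cor. 12.5.4's currency. [cite: Rogawski1990, §12.7 Lemma 12.7.2 (proof) p. 192; §12.7 p. 191; Prop. 12.5.2 p. 184; Cor. 12.5.4 p. 186]
[cite: vanDijk1972, Theorem (support of induced characters)] [cite: JacquetLanglands1970, §15–16] -/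
theorem innerG_up_charH_char_eq_zero_of_ldsInputs (𝔇 : EllipticData G H') (h1252 : 𝔇.Prop1252) (hM1H : 𝔇.PacketCharHRegularity)
    (πSt : IrrClass H') (hSt : ({πSt} : Finset (IrrClass H')) ∈ 𝔇.sqPacketsH)
    (hLds : ∀ P ∈ 𝔇.ldsPackets, ∃ (π₁ π₂ : IrrClass G) (χθ : H' → ℂ) (s : ℂ), P = {π₁, π₂} ∧
      Measurable χθ ∧ IsStableClassFunOn 𝔇.stConjH 𝔇.ellH χθ ∧
      𝔇.InnerGDefined (𝔇.up (𝔇.charH πSt)) (𝔇.up χθ) ∧ 𝔇.InnerHDefined (𝔇.charH πSt) χθ ∧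
      𝔇.innerH (𝔇.charH πSt) χθ = 0 ∧
      (∀ T ∈ 𝔇.cartanG, ∀ᵐ t : ↥T ∂(𝔇.μT T), 𝔇.char π₁ (t : G) + 𝔇.char π₂ (t : G) = 0) ∧
      (∀ T ∈ 𝔇.cartanG, ∀ᵐ t : ↥T ∂(𝔇.μT T), 𝔇.char π₁ (t : G) - 𝔇.char π₂ (t : G) = s * 𝔇.up χθ (t : G))) :
    ∀ P ∈ 𝔇.ldsPackets, ∀ π' ∈ P, 𝔇.innerG (𝔇.up (𝔇.charH πSt)) (𝔇.char π') = 0 := by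
  intro P hP π' hπ'
  obtain ⟨hmSt, hsSt⟩ := measurable_stable_charH_of_packetCharHRegularity 𝔇 hM1H πSt hSt
  obtain ⟨π₁, π₂, χθ, s, rfl, hmθ, hsθ, hG, hH, horthH, hsum, hsub⟩ := hLds P hP
  obtain ⟨h₁, h₂⟩ := char_ae_eq_const_mul_of_sum_zero_of_sub_eq 𝔇 π₁ π₂ (𝔇.up χθ) s hsum hsub
  rcases Finset.mem_insert.mp hπ' with rfl | hπ'
  · exact innerG_up_charH_char_eq_zero_of_inputs 𝔇 h1252 πSt _ hmSt hsSt χθ (s / 2) hmθ hsθ hG hH horthH h₁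
  · rw [Finset.mem_singleton] at hπ'
    subst hπ'
    exact innerG_up_charH_char_eq_zero_of_inputs 𝔇 h1252 πSt _ hmSt hsSt χθ (-(s / 2)) hmθ hsθ hG hH horthH h₂

end Generic

end Summit.HodgeConjecture.HodgeConjecture.Cruxes.H413.K2E3HInnerStVsLdsKappaZeroROfInputs

end
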